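import Summits.BirchSwinnertonDyer.Rank1Residual.Additive.SpecialJOrdinary
import Summits.BirchSwinnertonDyer.Rank1Residual.Additive.TypeGRamification
import Literature.NumberTheory.EllipticCurves.IwasawaSelmerOrdinaryProofs
import Literature.NumberTheory.EllipticCurves.HasseWeilGoodReductionFrobenius
import Mathlib.NumberTheory.NumberField.Cyclotomic.Ideal
import HarnessLib

/-!
# Additive classes X3/X4: (G) with `j ≡ 0` (`p ≡ 1 mod 3`) or `j ≡ 1728` (`p ≡ 1 mod 4`) is (G)-ORDINARY

HONEST FRAMING (cell `b2b-bsdres`, run/shared/lean/b2b/bsd-rank1-residual/, verbatim in every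
file): the goal of the cell is to DELETE the COMBINATION-SHAPED residual classes of the
Birch–Swinnerton-Dyer formula for ALL analytic-rank `≤ 1` elliptic curves over `ℚ` — "full BSD
formula for every rank `≤ 1` curve in class `C`" assembled STRICTLY from published theorems — so
that the rank-`≤ 1` remainder becomes exactly the CONSTRUCTION-SHAPED classes, which are TYPED
(missing-input `Prop`s), NOT attempted. This is not "finishing BSD". Sub-cell `additive-p2`
(X3/X4 at an additive prime, potentially good ORDINARY half): research route; no claim beyond the
stated classes; theorems only, no named fact; no label moves.

Number-field half of the ORDINARY refinement of the sub-cell's dictionary for the semistability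
defects `e ∈ {3, 4, 6}` (AUDIT-X34-GORD.md §3; `CyclotomicGoodReduction.lean`, "NOT transported
here"): Delbourgo's (G) (`TypeG`, good reduction above `p` over a subfield of `ℚ(ζ_p)`) together
with `j ≡ 0 (mod p)`, `p ≡ 1 (mod 3)` — resp. `j ≡ 1728 (mod p)`, `p ≡ 1 (mod 4)` — is (G) with
ORDINARY reduction, `TypeGOrd` (`PotGoodOrdinary.lean`). The data corollaries
(`SubGordHigher ⊆ TypeGOrd`, `ClassX3/4 ∧ SubGordHigher ⊆ ClassX3/4Gord`) are the sibling file
`SubGordHigherOrdinary.lean`.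

Chain (Serre–Tate; Silverman *AEC* VII.5, V.4; Deuring 1941):
* over a number field `F`, at a place `w` of GOOD reduction with `w(j) < 1` (resp.
  `w(j − 1728) < 1`) the reduced curve `Ẽ_w` of the local minimal model `X` has `c₄ = 0`, `j̃ = 0`
  (resp. `c₆ = 0`, `j̃ = 1728`): `c₄(X)³ = j·Δ_X`, `c₆(X)² = (j − 1728)·Δ_X` with `Δ_X` a `w`-unit
  (`reductionAt_c₄_eq_zero_of_valuation_j_lt_one`, `reductionAt_c₆_eq_zero_of_valuation_lt_one`);
* if the residue field has `p ≥ 5` elements and `3 ∣ p − 1` (resp. `4 ∣ p − 1`), `Ẽ_w` is ordinary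
  by Deuring's criterion (`SpecialJOrdinary.lean`): the tree's unit-root condition `HasUnitRootAt`
  (`hasUnitRootAt_of_valuation_j_lt_one`, `hasUnitRootAt_of_valuation_j_sub_lt_one`);
* in a subfield `F` of a `p`-th cyclotomic field every `w ∣ p` has residue degree `1`, `N(w) = p`
  (`absNorm_eq_of_intermediateField_cyclotomic`: Mathlib `IsCyclotomicExtension.Rat.inertiaDeg_eq_of_prime`
  and `Ideal.inertiaDeg_tower`), whence **`typeGOrd_of_typeG_of_padicValRat_j`** (`TypeG W p`,
  `W.j = 0 ∨ ord_p j > 0`, `3 ∣ p − 1`, `p ≥ 5` ⟹ `TypeGOrd W p`) and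
  **`typeGOrd_of_typeG_of_padicValRat_j_sub`** (`W.j = 1728 ∨ ord_p (j − 1728) > 0`, `4 ∣ p − 1`).

References: M. Deuring, Abh. Math. Sem. Hamburg 14 (1941); J.-P. Serre, J. Tate, Ann. of Math. 88
(1968) §2; J. H. Silverman, *AEC* VII.5.1, VII.2, V.4.1(a), Ex. V.4.4–4.5; D. Delbourgo, Compositio
Math. 113 (1998) §1.2 Lemma, §1.5 (G), Thm. 3; L. Washington, *Cyclotomic Fields* Prop. 2.3.
-/

noncomputable section

open scoped Classical NumberField

open WeierstrassCurve IsDedekindDomain IsDedekindDomain.HeightOneSpectrum NumberField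
  Literature.NumberTheory.EllipticCurves Literature.NumberTheory.EllipticCurves.Rank1Residual

namespace Summit.BirchSwinnertonDyer.Rank1Residual.Additive

/-! ### The reduced curve at a place of good reduction with `j ≡ 0` or `j ≡ 1728` -/

section Residue

variable {F : Type*} [Field F] [NumberField F] (V : WeierstrassCurve F) [V.IsElliptic]
  (w : HeightOneSpectrum (𝓞 F))

/-- Transfer of `< 1` between the global valuation `w.valuation F` and the valuation of the
completion `F_w` attached to the maximal ideal of `𝒪_w` (the two valuations on `F_w` are
equivalent, `isEquiv_valuation_maximalIdeal_valued`; `Valued.v` extends `w.valuation F`). -/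
theorem valuation_maximalIdeal_lt_one_iff (x : F) :
    (IsDiscreteValuationRing.maximalIdeal (w.adicCompletionIntegers F)).valuation
        (w.adicCompletion F) (algebraMap F (w.adicCompletion F) x) < 1 ↔
      w.valuation F x < 1 := by
  have hE := Literature.NumberTheory.EllipticCurves.isEquiv_valuation_maximalIdeal_valued w
  rw [(Valuation.isEquiv_iff_val_lt_one.mp hE), ← valuedAdicCompletion_eq_valuation' w x]
  rfl

/-- On the local minimal model `X` at `w`: `j(X) = j(E)` (in `F_w`), `c₄(X)³ = j·Δ_X` and
`c₆(X)² = (j − 1728)·Δ_X`. -/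
theorem localMinimalModel_c₄_pow_three_and_c₆_sq :
    (V.localMinimalModel w).c₄ ^ 3 =
        algebraMap F (w.adicCompletion F) V.j * (V.localMinimalModel w).Δ ∧
      (V.localMinimalModel w).c₆ ^ 2 =
        algebraMap F (w.adicCompletion F) (V.j - 1728) * (V.localMinimalModel w).Δ := by
  haveI := V.isElliptic_localMinimalModel w
  have hj' : (V.localMinimalModel w).j = algebraMap F (w.adicCompletion F) V.j := by
    show (((V.baseChange (w.adicCompletion F)).exists_isMinimal
      (w.adicCompletionIntegers F)).choose • V.baseChange (w.adicCompletion F)).j = _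
    rw [variableChange_j]
    exact V.map_j _
  have key : (V.localMinimalModel w).c₄ ^ 3 =
      (V.localMinimalModel w).j * (V.localMinimalModel w).Δ := by
    rw [WeierstrassCurve.j, ← coe_Δ', mul_comm ((↑(V.localMinimalModel w).Δ'⁻¹ : w.adicCompletion F)),
      mul_assoc, Units.inv_mul, mul_one]
  refine ⟨by rw [key, hj'], ?_⟩
  have hrel := (V.localMinimalModel w).c_relation
  rw [map_sub, ← hj', sub_mul, ← key]
  have h1728 : algebraMap F (w.adicCompletion F) 1728 = 1728 := map_ofNat _ _
  rw [h1728]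
  linear_combination hrel

/-- **`w(j) < 1` at a place of good reduction forces `c₄(Ẽ_w) = 0`** (`Ẽ_w` the reduction of the
local minimal model `X`): `c₄(X)³ = j·Δ_X` with `Δ_X` a `w`-unit, so `w(c₄(X)) < 1`, i.e. the
integral coefficient reduces to `0`. Silverman *AEC* VII.5.1, VII.2. -/
theorem reductionAt_c₄_eq_zero_of_valuation_j_lt_one (hgood : V.HasGoodReductionAt w)
    (hj : w.valuation F V.j < 1) : (V.reductionAt w).c₄ = 0 := by
  set O := w.adicCompletionIntegers F with hO
  set X := V.localMinimalModel w with hX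
  have hg : X.HasGoodReduction O := hgood
  haveI := hg.toIsMinimal
  set val := (IsDiscreteValuationRing.maximalIdeal O).valuation (w.adicCompletion F) with hval
  have hΔ1 : val X.Δ = 1 := hg.goodReduction
  have hjX : val (algebraMap F (w.adicCompletion F) V.j) < 1 :=
    (valuation_maximalIdeal_lt_one_iff w V.j).mpr hj
  have hc4 : val X.c₄ < 1 := by
    have h := congrArg val (localMinimalModel_c₄_pow_three_and_c₆_sq V w).1
    rw [map_pow, map_mul, hΔ1, mul_one] at h
    rw [← pow_lt_one_iff three_ne_zero, h]
    exact hjX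
  -- the integral coefficient lies in the maximal ideal
  have hmem : (X.integralModel O).c₄ ∈ IsLocalRing.maximalIdeal O := by
    rw [← integralModel_c₄_eq O X] at hc4
    exact (valuation_lt_one_iff_mem (IsDiscreteValuationRing.maximalIdeal O) _).mp hc4
  show ((X.integralModel O).map (IsLocalRing.residue O)).c₄ = 0
  rw [map_c₄, IsLocalRing.residue_eq_zero_iff]
  exact hmem

/-- **`w(j − 1728) < 1` at a place of good reduction forces `c₆(Ẽ_w) = 0`**:
`c₆(X)² = (j − 1728)·Δ_X`. -/
theorem reductionAt_c₆_eq_zero_of_valuation_lt_one (hgood : V.HasGoodReductionAt w)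
    (hj : w.valuation F (V.j - 1728) < 1) : (V.reductionAt w).c₆ = 0 := by
  set O := w.adicCompletionIntegers F with hO
  set X := V.localMinimalModel w with hX
  have hg : X.HasGoodReduction O := hgood
  haveI := hg.toIsMinimal
  set val := (IsDiscreteValuationRing.maximalIdeal O).valuation (w.adicCompletion F) with hval
  have hΔ1 : val X.Δ = 1 := hg.goodReduction
  have hjX : val (algebraMap F (w.adicCompletion F) (V.j - 1728)) < 1 :=
    (valuation_maximalIdeal_lt_one_iff w (V.j - 1728)).mpr hj
  have hc6 : val X.c₆ < 1 := by
    have h := congrArg val (localMinimalModel_c₄_pow_three_and_c₆_sq V w).2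
    rw [map_pow, map_mul, hΔ1, mul_one] at h
    rw [← pow_lt_one_iff two_ne_zero, h]
    exact hjX
  have hmem : (X.integralModel O).c₆ ∈ IsLocalRing.maximalIdeal O := by
    rw [← integralModel_c₆_eq O X] at hc6
    exact (valuation_lt_one_iff_mem (IsDiscreteValuationRing.maximalIdeal O) _).mp hc6
  show ((X.integralModel O).map (IsLocalRing.residue O)).c₆ = 0
  rw [map_c₆, IsLocalRing.residue_eq_zero_iff]
  exact hmem

/-- At a place of good reduction with `w(j) < 1` the reduced elliptic curve has `j̃ = 0`. -/
theorem reductionAt_j_eq_zero (hgood : V.HasGoodReductionAt w) [(V.reductionAt w).IsElliptic]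
    (hj : w.valuation F V.j < 1) : (V.reductionAt w).j = 0 :=
  j_eq_zero _ (reductionAt_c₄_eq_zero_of_valuation_j_lt_one V w hgood hj)

/-- At a place of good reduction with `w(j − 1728) < 1` the reduced elliptic curve has
`j̃ = 1728`. -/
theorem reductionAt_j_eq_of_valuation_lt_one (hgood : V.HasGoodReductionAt w)
    [(V.reductionAt w).IsElliptic] (hj : w.valuation F (V.j - 1728) < 1) :
    (V.reductionAt w).j = 1728 :=
  (SpecialJ.j_eq_iff_c₆_eq_zero _).mpr (reductionAt_c₆_eq_zero_of_valuation_lt_one V w hgood hj)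

variable {p : ℕ}

/-- **Good reduction with `j ≡ 0` at a degree-one place above `p ≡ 1 (mod 3)`, `p ≥ 5`, is
ORDINARY** (the tree's unit-root condition `HasUnitRootAt`: `p ∤ N(w) + 1 − #Ẽ_w(k_w)`): the reduced
curve over `k_w ≅ 𝔽_p` has `j̃ = 0` and Deuring's criterion applies
(`SpecialJ.not_dvd_trace_of_j_eq_zero_of_card_eq`). Silverman *AEC* V.4.1(a), Ex. V.4.4. -/
theorem hasUnitRootAt_of_valuation_j_lt_one (hp : p.Prime) (hp5 : 5 ≤ p) (h3 : 3 ∣ p - 1)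
    (hpw : (p : 𝓞 F) ∈ w.asIdeal) (hN : Ideal.absNorm w.asIdeal = p)
    (hgood : V.HasGoodReductionAt w) (hj : w.valuation F V.j < 1) : V.HasUnitRootAt w := by
  rw [WeierstrassCurve.hasUnitRootAt_iff_of_mem w V hp hpw, hN]
  haveI : (V.reductionAt w).IsElliptic := isElliptic_reductionAt hgood
  have hcard : Nat.card (IsLocalRing.ResidueField (w.adicCompletionIntegers F)) = p := by
    rw [WeierstrassCurve.natCard_residueField_eq_absNorm w, hN]
  have h := SpecialJ.not_dvd_trace_of_j_eq_zero_of_card_eq (V.reductionAt w) hp hp5 hcard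
    (reductionAt_j_eq_zero V w hgood hj) h3
  rwa [hcard] at h

/-- **Good reduction with `j ≡ 1728` at a degree-one place above `p ≡ 1 (mod 4)`, `p ≥ 5`, is
ORDINARY.** Silverman *AEC* V.4.1(a), Ex. V.4.5. -/
theorem hasUnitRootAt_of_valuation_j_sub_lt_one (hp : p.Prime) (hp5 : 5 ≤ p) (h4 : 4 ∣ p - 1)
    (hpw : (p : 𝓞 F) ∈ w.asIdeal) (hN : Ideal.absNorm w.asIdeal = p)
    (hgood : V.HasGoodReductionAt w) (hj : w.valuation F (V.j - 1728) < 1) :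
    V.HasUnitRootAt w := by
  rw [WeierstrassCurve.hasUnitRootAt_iff_of_mem w V hp hpw, hN]
  haveI : (V.reductionAt w).IsElliptic := isElliptic_reductionAt hgood
  have hcard : Nat.card (IsLocalRing.ResidueField (w.adicCompletionIntegers F)) = p := by
    rw [WeierstrassCurve.natCard_residueField_eq_absNorm w, hN]
  have h := SpecialJ.not_dvd_trace_of_j_eq_of_card_eq (V.reductionAt w) hp hp5 hcard
    (reductionAt_j_eq_of_valuation_lt_one V w hgood hj) h4
  rwa [hcard] at h

end Residue

/-! ### Residue degree one above `p` in subfields of `ℚ(ζ_p)` -/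

/-- **In a subfield `F` of a `p`-th cyclotomic field every prime `w ∣ p` has residue degree `1`**,
`N(w) = p`: choose `𝔓 ∣ w` in `ℚ(ζ_p)`; `f(𝔓|p) = f(w|p)·f(𝔓|w)` (Mathlib `Ideal.inertiaDeg_tower`)
and `f(𝔓|p) = 1` (Mathlib `IsCyclotomicExtension.Rat.inertiaDeg_eq_of_prime`: `p` is totally
ramified in `ℚ(ζ_p)`). Washington, *Cyclotomic Fields*, Prop. 2.3 / Lemma 1.4. -/
theorem absNorm_eq_of_intermediateField_cyclotomic {L : Type} [Field L] [NumberField L] (p : ℕ)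
    [hp : Fact p.Prime] [hcyc : IsCyclotomicExtension {p} ℚ L] (F : IntermediateField ℚ L)
    (w : HeightOneSpectrum (𝓞 F)) [hw : w.asIdeal.LiesOver (Ideal.span {(p : ℤ)})] :
    Ideal.absNorm w.asIdeal = p := by
  haveI : NumberField F := NumberField.of_module_finite ℚ F
  haveI := w.isMaximal
  obtain ⟨Q, hQmax, hQover⟩ :=
    Ideal.exists_maximal_ideal_liesOver_of_isIntegral (S := 𝓞 L) w.asIdeal
  haveI := hQover
  haveI : Q.IsPrime := hQmax.isPrime
  haveI : Q.LiesOver (Ideal.span {(p : ℤ)}) := Ideal.LiesOver.trans Q w.asIdeal _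
  have hQ1 : Q.inertiaDeg ℤ = 1 := IsCyclotomicExtension.Rat.inertiaDeg_eq_of_prime p L Q
  have htower : Q.inertiaDeg ℤ = w.asIdeal.inertiaDeg ℤ * Q.inertiaDeg (𝓞 F) :=
    Ideal.inertiaDeg_tower w.asIdeal Q
  rw [hQ1] at htower
  have hf : w.asIdeal.inertiaDeg ℤ = 1 := Nat.eq_one_of_mul_eq_one_right htower.symm
  haveI : (Ideal.span {(p : ℤ)}).IsMaximal :=
    Ideal.IsPrime.isMaximal
      ((Ideal.span_singleton_prime (by exact_mod_cast hp.out.ne_zero)).mpr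
        (Nat.prime_iff_prime_int.mp hp.out))
      (by rw [Ne, Ideal.span_singleton_eq_bot]; exact_mod_cast hp.out.ne_zero)
  rw [Ideal.absNorm_eq_pow_inertiaDeg' w.asIdeal hp.out, Ideal.inertiaDeg'_eq_inertiaDeg, hf,
    pow_one]

/-! ### `TypeG → TypeGOrd` when `j ≡ 0` (`p ≡ 1 mod 3`) or `j ≡ 1728` (`p ≡ 1 mod 4`) -/

section TypeG

variable (W : WeierstrassCurve ℚ) [W.IsElliptic] (p : ℕ) [hp : Fact p.Prime]

/-- At a place `w ∣ p` of a number field `F`: if `x = 0` or `ord_p x > 0` then `w(x) < 1`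
(`w(x) = v_p(x)^{e(w|p)}`, Mathlib `valuation_liesOver`). -/
theorem valuation_algebraMap_lt_one_of_padicValRat_pos {F : Type*} [Field F] [NumberField F]
    (w : HeightOneSpectrum (𝓞 F)) (hw : (p : 𝓞 F) ∈ w.asIdeal) {x : ℚ}
    (hx : x = 0 ∨ 0 < padicValRat p x) : w.valuation F (algebraMap ℚ F x) < 1 := by
  rcases hx with rfl | hx
  · rw [map_zero, map_zero]; exact zero_lt_one
  have hx0 : x ≠ 0 := by rintro rfl; simp at hx
  set v : HeightOneSpectrum ℤ := (Rat.HeightOneSpectrum.primesEquiv (R := ℤ)).symm ⟨p, hp.out⟩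
    with hvdef
  have hv : Rat.HeightOneSpectrum.natGenerator v = p :=
    congrArg Subtype.val ((Rat.HeightOneSpectrum.primesEquiv (R := ℤ)).apply_symm_apply ⟨p, hp.out⟩)
  have hunder : w.asIdeal.under ℤ = v.asIdeal := by
    have hle : v.asIdeal ≤ w.asIdeal.under ℤ := by
      rw [Rat.HeightOneSpectrum.asIdeal_eq_span_natGenerator_int, hv, Ideal.span_le,
        Set.singleton_subset_iff, SetLike.mem_coe, Ideal.under_def, Ideal.mem_comap, map_natCast]
      exact hw
    exact (v.isMaximal.eq_of_le (Ideal.IsPrime.ne_top inferInstance) hle).symm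
  haveI : w.asIdeal.LiesOver v.asIdeal := ⟨hunder.symm⟩
  have he : v.asIdeal.ramificationIdx' w.asIdeal ≠ 0 :=
    Ideal.IsDedekindDomain.ramificationIdx'_ne_zero_of_liesOver w.asIdeal v.ne_bot
  have hvx : v.valuation ℚ x < 1 := by
    rw [Rat.HeightOneSpectrum.valuation_eq_exp_neg_padicValRat v hx0, hv, ← WithZero.exp_zero,
      WithZero.exp_lt_exp]
    linarith
  rw [← valuation_liesOver (K := ℚ) (L := F) v w x]
  exact pow_lt_one₀ zero_le hvx he

/-- **(G) with `j ≡ 0 (mod p)` at `p ≡ 1 (mod 3)` is (G)-ORDINARY** (`p ≥ 5`): for the subfield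
`F ⊆ ℚ(ζ_p)` over which `E` acquires good reduction above `p` (Delbourgo's (G)), every `w ∣ p` has
residue field `𝔽_p` and reduced curve with `j̃ = 0`, ordinary by Deuring's criterion. This is the
`e ∈ {3, 6}` (Kodaira `IV, IV*, II, II*`) case of the dictionary. -/
theorem typeGOrd_of_typeG_of_padicValRat_j (hp5 : 5 ≤ p) (h3 : 3 ∣ p - 1) (hG : TypeG W p)
    (hj : W.j = 0 ∨ 0 < padicValRat p W.j) : TypeGOrd W p := by
  obtain ⟨L, iF, iN, iC, F, hF⟩ := hG
  refine ⟨L, iF, iN, iC, F, fun w hw ↦ ⟨hF w hw, ?_⟩⟩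
  haveI : NumberField F := NumberField.of_module_finite ℚ F
  haveI : (W.baseChange F).IsElliptic := by rw [baseChange]; infer_instance
  haveI : w.asIdeal.LiesOver (Ideal.span {(p : ℤ)}) := by
    refine ⟨((Ideal.IsPrime.isMaximal ?_ ?_).eq_of_le (Ideal.IsPrime.ne_top inferInstance) ?_)⟩
    · exact (Ideal.span_singleton_prime (by exact_mod_cast hp.out.ne_zero)).mpr
        (Nat.prime_iff_prime_int.mp hp.out)
    · rw [Ne, Ideal.span_singleton_eq_bot]; exact_mod_cast hp.out.ne_zero
    · rw [Ideal.span_le, Set.singleton_subset_iff, SetLike.mem_coe, Ideal.under_def,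
        Ideal.mem_comap, map_natCast]
      exact hw
  have hN := absNorm_eq_of_intermediateField_cyclotomic p F w
  have hjF : (W.baseChange F).j = algebraMap ℚ F W.j := W.map_j (algebraMap ℚ F)
  refine hasUnitRootAt_of_valuation_j_lt_one (W.baseChange F) w hp.out hp5 h3 hw hN (hF w hw) ?_
  rw [hjF]
  exact valuation_algebraMap_lt_one_of_padicValRat_pos p w hw hj

/-- **(G) with `j ≡ 1728 (mod p)` at `p ≡ 1 (mod 4)` is (G)-ORDINARY** (`p ≥ 5`): the `e = 4`
(Kodaira `III, III*`) case of the dictionary. -/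
theorem typeGOrd_of_typeG_of_padicValRat_j_sub (hp5 : 5 ≤ p) (h4 : 4 ∣ p - 1) (hG : TypeG W p)
    (hj : W.j = 1728 ∨ 0 < padicValRat p (W.j - 1728)) : TypeGOrd W p := by
  obtain ⟨L, iF, iN, iC, F, hF⟩ := hG
  refine ⟨L, iF, iN, iC, F, fun w hw ↦ ⟨hF w hw, ?_⟩⟩
  haveI : NumberField F := NumberField.of_module_finite ℚ F
  haveI : (W.baseChange F).IsElliptic := by rw [baseChange]; infer_instance
  haveI : w.asIdeal.LiesOver (Ideal.span {(p : ℤ)}) := by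
    refine ⟨((Ideal.IsPrime.isMaximal ?_ ?_).eq_of_le (Ideal.IsPrime.ne_top inferInstance) ?_)⟩
    · exact (Ideal.span_singleton_prime (by exact_mod_cast hp.out.ne_zero)).mpr
        (Nat.prime_iff_prime_int.mp hp.out)
    · rw [Ne, Ideal.span_singleton_eq_bot]; exact_mod_cast hp.out.ne_zero
    · rw [Ideal.span_le, Set.singleton_subset_iff, SetLike.mem_coe, Ideal.under_def,
        Ideal.mem_comap, map_natCast]
      exact hw
  have hN := absNorm_eq_of_intermediateField_cyclotomic p F w
  have hjF0 : (W.baseChange F).j = algebraMap ℚ F W.j := W.map_j (algebraMap ℚ F)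
  have hjF : (W.baseChange F).j - 1728 = algebraMap ℚ F (W.j - 1728) := by
    rw [map_sub, hjF0, map_ofNat]
  refine hasUnitRootAt_of_valuation_j_sub_lt_one (W.baseChange F) w hp.out hp5 h4 hw hN (hF w hw) ?_
  rw [hjF]
  refine valuation_algebraMap_lt_one_of_padicValRat_pos p w hw ?_
  rcases hj with h | h
  · left; rw [h, sub_self]
  · right; exact h

end TypeG

end Summit.BirchSwinnertonDyer.Rank1Residual.Additive

end
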